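import Mathlib
import Summits.ValiantsHypothesis.ValiantsHypothesis.Theses.ValuativeGCT
import Summits.ValiantsHypothesis.ValiantsHypothesis.Theorems.ValuativeGCTValuativeFlipEvenDegreeBite
import Summits.ValiantsHypothesis.ValiantsHypothesis.Theorems.ValuativeGCTValuativeFlipIntegralCutNormalization

/-!
# `ValuativeGCT.ValuativeFlip` (stmt-ValiantsHypothesis-12624), det census — A `Stab(det_m)`-INVARIANT FORM ON
# `End(ℂ^{m×m})` NOT INTEGRAL OVER THE PULLED-BACK COORDINATE RING OF `Δ(det_m)`, AT EVERY `m ≥ 3`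

Det-orbit-closure reading of the first-rung bite (wall-breaker axis "det-orbit-closure multiplicity bounds for the
det census").  The census lower bound of the axis (`ValuativeGCTValuativeFlipIntegralCutNormalization`,
`valuativeClause_of_isIntegral`): a homogeneous form of degree `m δ` on `End W` that is INTEGRAL over the subalgebra
`Φ(ℂ[Sym^m W*]) ⊆ ℂ[End W]` (`Φ = genericOrbitMap det_m m`, whose range is `ℂ[Δ(det_m)]` by `OrbitMapKernel`) lies
in `I(L_U)^(δ(m-r))` for EVERY admissible centre `(U, r)` — so it can never witness a cut.  The first-rung witness
(`frp_exists_witness_of_mem`: degree `m · 2`, `Stab_End(det_m)`-invariant, non-zero at a point of `L_U` for the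
admissible corner centre `Λ_3 ⊕ D_{m-3}`, `r = m - 1`) therefore is NOT integral over `Φ(ℂ[Sym^m W*])`:

* `exists_stabInvariant_not_isIntegral` — for every `m ≥ 3` there is a homogeneous form `G` of degree `m · 2` on
  `End(ℂ^{m×m})`, invariant under the crux's row action of every `M` with `linSubst M det_m = det_m`, with
  `¬ IsIntegral (genericOrbitMap (detFormLex ℂ m) m).range G`.

Since `Stab(det_m)`-invariant polynomial functions on `End W` restrict to regular functions on the orbit
`GL_{m²} · det_m` (BLMW §5.2: `ℂ[GL·det_m] = ℂ[GL]^{Stab}`), hence to rational functions on `Δ(det_m)`, this is an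
explicit element of `ℂ[End W]^{Stab} ∖ ℂ[Nor Δ(det_m)]` (a function with a pole on the normalisation) in the lowest
possible degree, uniformly in `m ≥ 3` — the strictness `ℂ[Nor Δ(det_m)] ≠ ℂ[GL·det_m]_{≥ 0}` behind Hüttenhain's
criterion (arXiv:1512.04352 Thm. 4; Landsberg 2017 Rem. 9.7.2.3 "with the skew witness"), here certified by the
level-2 blow-up and the valuative clause instead of a boundary computation.

References: J. Hüttenhain, *A note on normalizations of orbit closures*, Comm. Algebra 45 (2017) (arXiv:1512.04352)
Thm. 4; J. M. Landsberg, *Geometry and Complexity Theory* (2017) §9.7; BLMW, SIAM J. Comput. 40 (2011) §5.2;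
P. Bürgisser, C. Ikenmeyer, J. Hüttenhain, J. Algebra 477 (2017) (arXiv:1511.02927).
-/

namespace Summit.ValiantsHypothesis.ValiantsHypothesis.Theorems.ValuativeFlip

open Literature.NumberTheory.DiophantineGeometry Literature.Computability.AlgebraicComplexity
open MvPolynomial
open scoped BigOperators Matrix

-- `Summit.ValiantsHypothesis.ValiantsHypothesis.…` is the tree's mandated single-conjunct layout (Sub = Summit).
set_option linter.dupNamespace false

noncomputable section

/-- **A `Stab(det_m)`-invariant form of degree `2m` not integral over `Φ(ℂ[Sym^m W*]) ≅ ℂ[Δ(det_m)]`, every `m ≥ 3`.**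
The first-rung witness along the admissible corner centre `Λ_3 ⊕ D_{m-3}` (`r = m - 1`): were it integral, the
valuative clause (`valuativeClause_of_isIntegral`) would put it in `I(L_U)^(2(m-r)) ⊆ I(L_U)`, contradicting its
non-zero value at a point of `L_U`. [arXiv:1512.04352 Thm. 4; folklore] -/
theorem exists_stabInvariant_not_isIntegral (m : ℕ) [NeZero m] (h3 : 3 ≤ m) :
    ∃ G : MvPolynomial (MatIdx m × MatIdx m) ℂ, G.IsHomogeneous (m * 2) ∧
      (∀ M : Matrix (MatIdx m) (MatIdx m) ℂ, linSubst (MatIdx m) ℂ M (detFormLex ℂ m) = detFormLex ℂ m →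
        MvPolynomial.aeval (R := ℂ) (fun q : MatIdx m × MatIdx m =>
          ∑ l : MatIdx m, M l q.2 • (X (q.1, l) : MvPolynomial (MatIdx m × MatIdx m) ℂ)) G = G) ∧
      ¬ IsIntegral (genericOrbitMap (detFormLex ℂ m) m).range G := by
  obtain ⟨n, rfl⟩ := Nat.exists_eq_add_of_le h3
  have hA : ∀ (A : Matrix (Fin 3) (Fin 3) ℂ), Aᵀ = -A → ∀ i j, A i j = -A j i := fun A hA i j => by
    have := congr_fun (congr_fun hA j) i
    simpa only [Matrix.transpose_apply, Matrix.neg_apply] using this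
  have h0 : ∀ i j : Fin n, i ≠ j → (0 : Matrix (Fin n) (Fin n) ℂ) i j = 0 := fun _ _ _ => rfl
  have h1 : ∀ i j : Fin n, i ≠ j → (1 : Matrix (Fin n) (Fin n) ℂ) i j = 0 := fun _ _ h => Matrix.one_apply_ne h
  have hz : ∀ i j : Fin 3, (0 : Matrix (Fin 3) (Fin 3) ℂ) i j = -(0 : Matrix (Fin 3) (Fin 3) ℂ) j i := by simp
  obtain ⟨G, p, hGh, hGs, hpU, hGp⟩ := frp_exists_witness_of_mem finSumFinEquiv (1 : Matrix (Fin n) (Fin n) ℂ)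
    (by rw [Matrix.det_one]; exact one_ne_zero) _
    (frc_mem_cornerCentre (hA _ frc_sP_transpose) h0) (frc_mem_cornerCentre (hA _ frc_sQ_transpose) h0)
    (frc_mem_cornerCentre (hA _ frc_sR_transpose) h0) (frc_mem_cornerCentre hz h1)
  refine ⟨G, hGh, hGs, fun hint => hGp ?_⟩
  -- the valuative clause for the admissible corner centre (`r = 3 + n - 1`, threshold `2 · 1`)
  have hmem := valuativeClause_of_isIntegral (3 + n) _ (3 + n - 1) (cornerCentre_rank_le n) 2 G hGh hint
  rw [show 2 * (3 + n - (3 + n - 1)) = 2 by omega] at hmem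
  have h1' : G ∈ MvPolynomial.vanishingIdeal ℂ {q : MatIdx (3 + n) × MatIdx (3 + n) → ℂ |
      ∀ j : MatIdx (3 + n), (fun i => q (j, i)) ∈ Submodule.span ℂ {u : MatIdx (3 + n) → ℂ |
        (∀ a b : Fin (3 + n), (a : ℕ) < 3 → (b : ℕ) < 3 → u (toLex (a, b)) = -u (toLex (b, a))) ∧
        (∀ a b : Fin (3 + n), a ≠ b → (3 ≤ (a : ℕ) ∨ 3 ≤ (b : ℕ)) → u (toLex (a, b)) = 0)}} :=
    (Ideal.pow_le_self two_ne_zero) hmem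
  rw [mem_vanishingIdeal_iff] at h1'
  simpa [MvPolynomial.coe_aeval_eq_eval] using h1' p hpU

end

end Summit.ValiantsHypothesis.ValiantsHypothesis.Theorems.ValuativeFlip
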